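/-
Copyright (c) 2026 the pub-hodgecm-mathlib formalisation cell (harness21).  R90-TF SLAB, section S10 (Rogawski 1990, Ch. 13.8 read at `v`), prover R90-C138-p04 (g2) —
DEAL #91 (dealer R90-C138-plan (g4), 2026-09-05): the S5∕S6 → S10 read-backs of FILE D's blocks (D1)₂ `StableVanishingHyp`, (D2-H) `HGermExpansionHyp`, (D4-H) `HCoeffAtT0Hyp`
(body currency; Theorems cannot import `Lines`); h413 = `stmt-HodgeConjecture-24833`, route `HCCMUnconditional`.
-/
import Summits.HodgeConjecture.HodgeConjecture.Theorems.R90S10FrozenFamilyMaps       -- ★ W1-H3: `S10Frozen.ΦGu`, `UnrQs` (+ ★ C2 `S10HDatum`∕`S10Frozen`, `MatchE1`, carriers, E1 `DiscreteClass.classTrace`)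
import Literature.NumberTheory.Rogawski1990.StabilisationIdentities                  -- ★ `StabilisationData` (`θG`, `SθH`, `SθG`, `transfer`, `StablyZero`, `Thm1031b`)
import HarnessLib

/-!
# R90-TF ∕ S10 — THE S5∕S6 → S10 READ-BACKS OF THE STABILISATION BLOCKS (D1)₂, (D2-H), (D4-H) (`Theorems/R90S10StabBlocksReadback.lean`; ns `Summit.HodgeConjecture.HodgeConjecture.R90.S10`)

Cell `hodgecm-mathlib`, crux H413 (`stmt-HodgeConjecture-24833`), route of record `HCCMUnconditional`; programme R90-TF, section S10 (base `R90-C138`).  PROOF lane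
(`--kind proof --supports stmt-HodgeConjecture-24833 --as helper`): theorems only; no `def`, no instance, no notation, no `sorry`; imports ★ only — `Theorems` cannot import
`Cruxes/…/Lines`, so FILE D's three block predicates (`Lines/R90_S10_TFDecompositionD.lean`)
  `StableVanishingHyp L v θG SθH ΦGu ΦHu Match := ∀ u fH φ, Match fH φ → sThetaG θG SθH (ΦGu u φ) (ΦHu u fH) = 0` (:137; `sThetaG θ S f fH := θ f − ½ · S fH`, :126),
  `HGermExpansionHyp L v 𝔖 ΦHu Match hat cH := ∀ u fH φ, Match fH φ → Summable (t ↦ cH t fH · hat t u) ∧ 𝔖.SθH (ΦHu u fH) = Σ' t, cH t fH · hat t u` (:246),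
  `HCoeffAtT0Hyp L v Match trH cH t₀ := ∀ fH φ, Match fH φ → cH t₀ fH = trH fH` (:299)
are plain `def`s (unfolding = `Iff.rfl`, certified by import in the probe `R90/R90-C138-p04/g2/Probe_StabBlocks_IffRfl.lean`) and are handled here THROUGH THEIR BODIES, token
for token as the ★ keystone p865101 `stabilisedAtEvp_of_inputs` binds them (`hD1` :159–:160, `hH` :170–:172, `hH4` :174–:175) — so that the S6 pen ((D1)₂: Thm. 10.3.1 (b)
«`SΘ_G` is a stable distribution» + transfer + stably-null members), the S5 pens ((D2-H): Prop. 13.6.1, the absolutely convergent e.v.p. expansion of `SΘ_H`; (D4-H): Lemma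
13.6.3 (a)(b), the `H`-coefficient at `t₀` is the packet trace) have CITABLE TARGETS whatever stabilisation datum `𝔖` LEAD names (J-𝔖), in both directions.

CONTENTS.  §1 generic (`TG TH Unr Germ`, any `Match`): (D1) `stableVanishing_iff_eq_half` (`θ_G − ½ SΘ_H = 0 ↔ θ_G = ½ SΘ_H` on the matched family),
`stableVanishing_of_stable` (S6's supply: a STABLE `SΘ_G`, i.e. `transfer f fH → StablyZero f → θ_G f − ½ SΘ_H fH = 0`, + «the family members are transfer pairs» + «every
member is stably null» ⇒ (D1)₂'s body), `stableVanishing_of_thm1031b_body` (the same from ★ `StabilisationData.Thm1031b`); (D2-H) `hGermExpansion_of_forall` (S5's supply on a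
`Match`-free class of `f^H`), `hGermExpansion_iff_exists` (`φ` enters only through `Match`); (D4-H) `hCoeffAtT0_of_forall`, `hCoeffAtT0_iff_exists`.  §2 at the frozen datum
(`Φ := 𝔳.ΦGu S`, `Match := MatchE1 L μ v mHv mQv`, `Unr := UnrQs L S`): `stableVanishing_frozen_of_stable`, `hGermExpansion_frozen_of_locSmooth`,
`hCoeffAtT0_frozen_of_locSmooth` (the H-side hypotheses read on locally smooth `f^H`, which `MatchE1` guarantees) and `hCoeffAtT0_frozen_packetTrace_of_locSmooth` at the
keystone's `trH := f^H ↦ Σᶠ_j m(ρ_j) · Tr ρ_j(𝔳.ΦH f^H)`.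
HONEST LABEL: bookkeeping over ★ definitions; proves nothing printed (Thm. 10.3.1 (b), Prop. 13.6.1, Lemma 13.6.3 stay the S6∕S5 pens' targets); closes no socket; HC_CM is
proved only modulo the 7 printed citations (2 remaining named inputs: hLiu418 = `stmt-HodgeConjecture-24832`, h413 = `stmt-HodgeConjecture-24833`) until rung 0 closes;
REL ≠ ★ ≠ BUILT; count-neutral.

## References
* [Rogawski1990] J. D. Rogawski, *Automorphic Representations of Unitary Groups in Three Variables*, Ann. of Math. Stud. 123 (1990), §10.3 Thm. 10.3.1 (b) pp. 157–160;
  §13.6 Prop. 13.6.1 p. 209, Lemma 13.6.3 p. 210; §13.7 p. 211; §13.8 p. 218.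
-/

set_option autoImplicit false
set_option linter.dupNamespace false

noncomputable section

open scoped RestrictedProduct
open Filter MeasureTheory NumberField IsDedekindDomain CompactlySupported Topology
open Literature.NumberTheory.Rogawski1990 Literature.NumberTheory.Automorphic Literature.NumberTheory.Automorphic.UnitaryGroup
open Literature.NumberTheory.GaloisRepresentations (HeckeCharacter)
open Summit.HodgeConjecture.HodgeConjecture.Cruxes.H413
open Summit.HodgeConjecture.HodgeConjecture.Cruxes.H413.K2E1TraceFormulaBeta
open Summit.HodgeConjecture.HodgeConjecture.Cruxes.H413.K2E1GlobalTestFunctions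
open Summit.HodgeConjecture.HodgeConjecture.Cruxes.H413.K2E1SpectralTermsDiscreteHalf

namespace Summit.HodgeConjecture.HodgeConjecture.R90.S10

/-! ## §1 Generic read-backs and supply shapes -/

section Generic

variable {L : Type} [Field L] [NumberField L] [IsCMField L] {v : Pl L} {TG TH Unr Germ : Type*}

/-- **(D1)₂ both ways: `θ_G(f) − ½ SΘ_H(f^H) = 0` on the matched frozen family ↔ `θ_G(f) = ½ SΘ_H(f^H)` there.** [cite: Rogawski1990, §13.8 p. 218; §10.3 p. 159] -/
theorem stableVanishing_iff_eq_half (thetaG : TG → ℂ) (sThetaH : TH → ℂ) (ΦGu : Unr → (Gqs L v → ℂ) → TG) (ΦHu : Unr → (HLoc L v → ℂ) → TH)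
    (Match : (HLoc L v → ℂ) → (Gqs L v → ℂ) → Prop) :
    (∀ (u : Unr) (fH : HLoc L v → ℂ) (φ : Gqs L v → ℂ), Match fH φ → thetaG (ΦGu u φ) - (1 / 2 : ℂ) * sThetaH (ΦHu u fH) = 0) ↔
      ∀ (u : Unr) (fH : HLoc L v → ℂ) (φ : Gqs L v → ℂ), Match fH φ → thetaG (ΦGu u φ) = (1 / 2 : ℂ) * sThetaH (ΦHu u fH) := by
  simp only [sub_eq_zero]

/-- **S6's supply shape for (D1)₂**: a STABLE `SΘ_G` («if all stable orbital integrals of `f` vanish then `SΘ_G(f) = 0`», Thm. 10.3.1 (b)) read as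
`transfer f fH → StablyZero f → θ_G f − ½ SΘ_H fH = 0`, together with «the family members `(Φ_u φ, Φ^H_u f^H)` are transfer pairs» and «every `Φ_u φ` is stably null»
(`f_u = f_{1u} − f_{2u}`), gives (D1)₂'s body. [cite: Rogawski1990, §10.3 Thm. 10.3.1 (b) pp. 157–160; §13.8 p. 218 L20–L21] -/
theorem stableVanishing_of_stable (thetaG : TG → ℂ) (sThetaH : TH → ℂ) (ΦGu : Unr → (Gqs L v → ℂ) → TG) (ΦHu : Unr → (HLoc L v → ℂ) → TH)
    (Match : (HLoc L v → ℂ) → (Gqs L v → ℂ) → Prop) (transfer : TG → TH → Prop) (StablyZero : TG → Prop)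
    (hstable : ∀ (f : TG) (fH : TH), transfer f fH → StablyZero f → thetaG f - (1 / 2 : ℂ) * sThetaH fH = 0)
    (htr : ∀ (u : Unr) (fH : HLoc L v → ℂ) (φ : Gqs L v → ℂ), Match fH φ → transfer (ΦGu u φ) (ΦHu u fH))
    (hsz : ∀ (u : Unr) (φ : Gqs L v → ℂ), StablyZero (ΦGu u φ)) :
    ∀ (u : Unr) (fH : HLoc L v → ℂ) (φ : Gqs L v → ℂ), Match fH φ → thetaG (ΦGu u φ) - (1 / 2 : ℂ) * sThetaH (ΦHu u fH) = 0 :=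
  fun u fH φ hM => hstable _ _ (htr u fH φ hM) (hsz u φ)

/-- **(D1)₂ from ★ `StabilisationData.Thm1031b`** («`SΘ_G` is a stable distribution», `SΘ_G f fH := θ_G f − ½ SΘ_H fH`), the transfer property of the family and the
stable nullity of its members — FILE D's `stableVanishing_of_thm1031b` in body currency. [cite: Rogawski1990, §10.3 Thm. 10.3.1 (b) pp. 157–160; §13.8 p. 218] -/
theorem stableVanishing_of_thm1031b_body (𝔖 : StabilisationData TG TH) (ΦGu : Unr → (Gqs L v → ℂ) → TG) (ΦHu : Unr → (HLoc L v → ℂ) → TH)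
    (Match : (HLoc L v → ℂ) → (Gqs L v → ℂ) → Prop) (h1031b : 𝔖.Thm1031b)
    (htr : ∀ (u : Unr) (fH : HLoc L v → ℂ) (φ : Gqs L v → ℂ), Match fH φ → 𝔖.transfer (ΦGu u φ) (ΦHu u fH))
    (hsz : ∀ (u : Unr) (φ : Gqs L v → ℂ), 𝔖.StablyZero (ΦGu u φ)) :
    ∀ (u : Unr) (fH : HLoc L v → ℂ) (φ : Gqs L v → ℂ), Match fH φ → 𝔖.θG (ΦGu u φ) - (1 / 2 : ℂ) * 𝔖.SθH (ΦHu u fH) = 0 :=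
  fun u fH φ hM => h1031b _ _ (htr u fH φ hM) (hsz u φ)

/-- **S5's supply shape for (D2-H)**: an absolutely convergent e.v.p. expansion of `SΘ_H` on the frozen `H`-family, proved for every `f^H` in a `Match`-free class `P`
(e.g. locally smooth), gives (D2-H)'s body (Prop. 13.6.1 regrouped by germs). [cite: Rogawski1990, §13.6 Prop. 13.6.1 p. 209; §13.7 p. 211] -/
theorem hGermExpansion_of_forall (SθH : TH → ℂ) (ΦHu : Unr → (HLoc L v → ℂ) → TH) (Match : (HLoc L v → ℂ) → (Gqs L v → ℂ) → Prop)
    (hat : Germ → Unr → ℂ) (cH : Germ → (HLoc L v → ℂ) → ℂ) (P : (HLoc L v → ℂ) → Prop) (hP : ∀ (fH : HLoc L v → ℂ) (φ : Gqs L v → ℂ), Match fH φ → P fH)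
    (hexp : ∀ (u : Unr) (fH : HLoc L v → ℂ), P fH → (Summable fun t : Germ => cH t fH * hat t u) ∧ SθH (ΦHu u fH) = ∑' t : Germ, cH t fH * hat t u) :
    ∀ (u : Unr) (fH : HLoc L v → ℂ) (φ : Gqs L v → ℂ), Match fH φ →
      (Summable fun t : Germ => cH t fH * hat t u) ∧ SθH (ΦHu u fH) = ∑' t : Germ, cH t fH * hat t u :=
  fun u fH φ hM => hexp u fH (hP fH φ hM)

/-- **(D2-H) both ways: `φ` enters only through `Match`** — the body ↔ the expansion for every `f^H` matched to SOME `φ`. [cite: Rogawski1990, §13.6 Prop. 13.6.1 p. 209] -/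
theorem hGermExpansion_iff_exists (SθH : TH → ℂ) (ΦHu : Unr → (HLoc L v → ℂ) → TH) (Match : (HLoc L v → ℂ) → (Gqs L v → ℂ) → Prop)
    (hat : Germ → Unr → ℂ) (cH : Germ → (HLoc L v → ℂ) → ℂ) :
    (∀ (u : Unr) (fH : HLoc L v → ℂ) (φ : Gqs L v → ℂ), Match fH φ →
        (Summable fun t : Germ => cH t fH * hat t u) ∧ SθH (ΦHu u fH) = ∑' t : Germ, cH t fH * hat t u) ↔
      ∀ (u : Unr) (fH : HLoc L v → ℂ), (∃ φ : Gqs L v → ℂ, Match fH φ) →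
        (Summable fun t : Germ => cH t fH * hat t u) ∧ SθH (ΦHu u fH) = ∑' t : Germ, cH t fH * hat t u :=
  ⟨fun h u fH ⟨φ, hM⟩ => h u fH φ hM, fun h u fH φ hM => h u fH ⟨φ, hM⟩⟩

/-- **S5's supply shape for (D4-H)**: «of the terms of `SΘ_H(f^H)` only `ρ` yields `t₀`» proved for every `f^H` in a `Match`-free class `P` gives (D4-H)'s body.
[cite: Rogawski1990, §13.6 Lemma 13.6.3 (a)(b) p. 210; §13.7 line (3) p. 211] -/
theorem hCoeffAtT0_of_forall (Match : (HLoc L v → ℂ) → (Gqs L v → ℂ) → Prop) (trH : (HLoc L v → ℂ) → ℂ) (cH : Germ → (HLoc L v → ℂ) → ℂ) (t₀ : Germ)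
    (P : (HLoc L v → ℂ) → Prop) (hP : ∀ (fH : HLoc L v → ℂ) (φ : Gqs L v → ℂ), Match fH φ → P fH) (hco : ∀ fH : HLoc L v → ℂ, P fH → cH t₀ fH = trH fH) :
    ∀ (fH : HLoc L v → ℂ) (φ : Gqs L v → ℂ), Match fH φ → cH t₀ fH = trH fH :=
  fun fH φ hM => hco fH (hP fH φ hM)

/-- **(D4-H) both ways: `φ` enters only through `Match`.** [cite: Rogawski1990, §13.6 Lemma 13.6.3 (a)(b) p. 210] -/
theorem hCoeffAtT0_iff_exists (Match : (HLoc L v → ℂ) → (Gqs L v → ℂ) → Prop) (trH : (HLoc L v → ℂ) → ℂ) (cH : Germ → (HLoc L v → ℂ) → ℂ) (t₀ : Germ) :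
    (∀ (fH : HLoc L v → ℂ) (φ : Gqs L v → ℂ), Match fH φ → cH t₀ fH = trH fH) ↔
      ∀ fH : HLoc L v → ℂ, (∃ φ : Gqs L v → ℂ, Match fH φ) → cH t₀ fH = trH fH :=
  ⟨fun h fH ⟨φ, hM⟩ => h fH φ hM, fun h fH φ hM => h fH ⟨φ, hM⟩⟩

end Generic

/-! ## §2 At the frozen datum of record: `Φ := 𝔳.ΦGu S`, `Match := MatchE1 L μ v mHv mQv`, `Unr := UnrQs L S` -/

section Frozen

variable {L : Type} [Field L] [NumberField L] [IsCMField L] [DecidableEq (Pl L)] {μ : HeckeCharacter L} {v : Pl L}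
  [MeasurableSpace (HLoc L v)] [BorelSpace (HLoc L v)] [MeasurableSpace (Gqs L v)] [BorelSpace (Gqs L v)]
  {νHv : Measure (HLoc L v)} {νQv : Measure (Gqs L v)} [νHv.IsHaarMeasure] [νHv.IsMulRightInvariant] [νQv.IsHaarMeasure] [νQv.IsMulRightInvariant]
  [∀ a : HLoc L v, MeasurableSpace (HLoc L v ⧸ Subgroup.centralizer ({a} : Set (HLoc L v)))]
  [∀ a : HLoc L v, BorelSpace (HLoc L v ⧸ Subgroup.centralizer ({a} : Set (HLoc L v)))]
  [∀ γ : Gqs L v, MeasurableSpace (Gqs L v ⧸ Subgroup.centralizer ({γ} : Set (Gqs L v)))]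
  [∀ γ : Gqs L v, BorelSpace (Gqs L v ⧸ Subgroup.centralizer ({γ} : Set (Gqs L v)))]
  {mHv : OrbitalMeasureFamily (HLoc L v)} {mQv : OrbitalMeasureFamily (Gqs L v)} {πSt : IrrClass (HLoc L v)}
  [MeasurableSpace (H2 L).Adelic] [BorelSpace (H2 L).Adelic]
  [MeasurableSpace (GArch L)] [BorelSpace (GArch L)] [MeasurableSpace (HArch L)] [BorelSpace (HArch L)]
  [MeasurableSpace (H1Loc L v)] [MeasurableSpace (H1Arch L)] [MeasurableSpace (H1 L).Adelic] [BorelSpace (H1 L).Adelic]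
  {𝔥 : S10HDatum L μ v νHv νQv mHv mQv πSt}

/-- **(D1)₂ at the frozen datum from a STABLE `SΘ_G`** (keystone binder `hD1` :159–:160, token for token): transfer pairs + stably null members ⇒
`𝔖.θG (𝔳.ΦGu S u φ) − ½ · 𝔖.SθH (ΦHu u fH) = 0` for every `E1`-matched `(f^H, φ)`. [cite: Rogawski1990, §10.3 Thm. 10.3.1 (b) pp. 157–160; §13.8 p. 218 L20–L21] -/
theorem stableVanishing_frozen_of_stable (𝔳 : S10Frozen L μ v νHv νQv mHv mQv πSt 𝔥) (S : Set (Pl L))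
    {TH : Type*} (𝔖 : StabilisationData (GlobalTestFunction L 3 (qsForm L)) TH) (ΦHu : UnrQs L S → (HLoc L v → ℂ) → TH)
    (hstable : ∀ (f : GlobalTestFunction L 3 (qsForm L)) (fH : TH), 𝔖.transfer f fH → 𝔖.StablyZero f → 𝔖.θG f - (1 / 2 : ℂ) * 𝔖.SθH fH = 0)
    (htr : ∀ (u : UnrQs L S) (fH : HLoc L v → ℂ) (φ : Gqs L v → ℂ), MatchE1 L μ v mHv mQv fH φ → 𝔖.transfer (𝔳.ΦGu S u φ) (ΦHu u fH))
    (hsz : ∀ (u : UnrQs L S) (φ : Gqs L v → ℂ), 𝔖.StablyZero (𝔳.ΦGu S u φ)) :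
    ∀ (u : UnrQs L S) (fH : HLoc L v → ℂ) (φ : Gqs L v → ℂ), MatchE1 L μ v mHv mQv fH φ →
      𝔖.θG (𝔳.ΦGu S u φ) - (1 / 2 : ℂ) * 𝔖.SθH (ΦHu u fH) = 0 :=
  stableVanishing_of_stable 𝔖.θG 𝔖.SθH (𝔳.ΦGu S) ΦHu (MatchE1 L μ v mHv mQv) 𝔖.transfer 𝔖.StablyZero hstable htr hsz

omit [DecidableEq (Pl L)] [MeasurableSpace (HLoc L v)] [BorelSpace (HLoc L v)] [MeasurableSpace (Gqs L v)] [BorelSpace (Gqs L v)] [νHv.IsHaarMeasure]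
  [νHv.IsMulRightInvariant] [νQv.IsHaarMeasure] [νQv.IsMulRightInvariant] [∀ a : HLoc L v, BorelSpace (HLoc L v ⧸ Subgroup.centralizer ({a} : Set (HLoc L v)))]
  [∀ γ : Gqs L v, BorelSpace (Gqs L v ⧸ Subgroup.centralizer ({γ} : Set (Gqs L v)))] [MeasurableSpace (H2 L).Adelic] [BorelSpace (H2 L).Adelic]
  [MeasurableSpace (GArch L)] [BorelSpace (GArch L)] [MeasurableSpace (HArch L)] [BorelSpace (HArch L)] [MeasurableSpace (H1Loc L v)] [MeasurableSpace (H1Arch L)]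
  [MeasurableSpace (H1 L).Adelic] [BorelSpace (H1 L).Adelic] in
/-- **(D2-H) at the frozen datum from an expansion on LOCALLY SMOOTH `f^H`** (keystone binder `hH` :170–:172, token for token; `MatchE1`'s first conjunct is
`IsLocSmooth f^H`). [cite: Rogawski1990, §13.6 Prop. 13.6.1 p. 209; §13.7 p. 211] -/
theorem hGermExpansion_frozen_of_locSmooth (S : Set (Pl L)) {TH Germ : Type*} (SθH : TH → ℂ) (ΦHu : UnrQs L S → (HLoc L v → ℂ) → TH)
    (hat : Germ → UnrQs L S → ℂ) (cH : Germ → (HLoc L v → ℂ) → ℂ)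
    (hexp : ∀ (u : UnrQs L S) (fH : HLoc L v → ℂ), IsLocSmooth fH →
      (Summable fun t : Germ => cH t fH * hat t u) ∧ SθH (ΦHu u fH) = ∑' t : Germ, cH t fH * hat t u) :
    ∀ (u : UnrQs L S) (fH : HLoc L v → ℂ) (φ : Gqs L v → ℂ), MatchE1 L μ v mHv mQv fH φ →
      (Summable fun t : Germ => cH t fH * hat t u) ∧ SθH (ΦHu u fH) = ∑' t : Germ, cH t fH * hat t u :=
  hGermExpansion_of_forall SθH ΦHu (MatchE1 L μ v mHv mQv) hat cH IsLocSmooth (fun _ _ hM => hM.1) hexp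

omit [DecidableEq (Pl L)] [MeasurableSpace (HLoc L v)] [BorelSpace (HLoc L v)] [MeasurableSpace (Gqs L v)] [BorelSpace (Gqs L v)] [νHv.IsHaarMeasure]
  [νHv.IsMulRightInvariant] [νQv.IsHaarMeasure] [νQv.IsMulRightInvariant] [∀ a : HLoc L v, BorelSpace (HLoc L v ⧸ Subgroup.centralizer ({a} : Set (HLoc L v)))]
  [∀ γ : Gqs L v, BorelSpace (Gqs L v ⧸ Subgroup.centralizer ({γ} : Set (Gqs L v)))] [MeasurableSpace (H2 L).Adelic] [BorelSpace (H2 L).Adelic]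
  [MeasurableSpace (GArch L)] [BorelSpace (GArch L)] [MeasurableSpace (HArch L)] [BorelSpace (HArch L)] [MeasurableSpace (H1Loc L v)] [MeasurableSpace (H1Arch L)]
  [MeasurableSpace (H1 L).Adelic] [BorelSpace (H1 L).Adelic] in
/-- **(D4-H) at the frozen datum from the coefficient identity on LOCALLY SMOOTH `f^H`** (keystone binder `hH4` :174–:175 shape, generic `trH`).
[cite: Rogawski1990, §13.6 Lemma 13.6.3 (a)(b) p. 210; §13.7 line (3) p. 211] -/
theorem hCoeffAtT0_frozen_of_locSmooth {Germ : Type*} (trH : (HLoc L v → ℂ) → ℂ) (cH : Germ → (HLoc L v → ℂ) → ℂ) (t₀ : Germ)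
    (hco : ∀ fH : HLoc L v → ℂ, IsLocSmooth fH → cH t₀ fH = trH fH) :
    ∀ (fH : HLoc L v → ℂ) (φ : Gqs L v → ℂ), MatchE1 L μ v mHv mQv fH φ → cH t₀ fH = trH fH :=
  hCoeffAtT0_of_forall (MatchE1 L μ v mHv mQv) trH cH t₀ IsLocSmooth (fun _ _ hM => hM.1) hco

/-- **(D4-H) at the frozen datum, AT THE PACKET TRACE OF RECORD** (keystone binder `hH4` :174–:175, token for token): the `H`-coefficient at `t₀` is
`Σᶠ_j m(ρ_j) · Tr ρ_j(𝔳.ΦH f^H)` over the packet cut `𝔥.dρ`, for every `E1`-matched `(f^H, φ)`, from the same identity on locally smooth `f^H`.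
[cite: Rogawski1990, §13.6 Lemma 13.6.3 (a)(b) p. 210; §13.7 line (3) p. 211; §13.8 display (13.8.3) p. 218] -/
theorem hCoeffAtT0_frozen_packetTrace_of_locSmooth (𝔳 : S10Frozen L μ v νHv νQv mHv mQv πSt 𝔥) {Germ : Type*} (cH : Germ → (HLoc L v → ℂ) → ℂ) (t₀ : Germ)
    (hco : haveI := 𝔥.hμH; haveI := 𝔥.hνH; ∀ fH : HLoc L v → ℂ, IsLocSmooth fH →
      cH t₀ fH = ∑ᶠ j, (((𝔥.dρ j).mult).toNat : ℂ) * (𝔥.dρ j).classTrace 𝔥.νH (𝔳.ΦH fH)) :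
    haveI := 𝔥.hμH
    haveI := 𝔥.hνH
    ∀ (fH : HLoc L v → ℂ) (φ : Gqs L v → ℂ), MatchE1 L μ v mHv mQv fH φ →
      cH t₀ fH = ∑ᶠ j, (((𝔥.dρ j).mult).toNat : ℂ) * (𝔥.dρ j).classTrace 𝔥.νH (𝔳.ΦH fH) :=
  fun fH _ hM => hco fH hM.1

end Frozen

end Summit.HodgeConjecture.HodgeConjecture.R90.S10

end
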